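import Literature.Computability.ImplicitComplexity.SoftTypeAssignmentLeftmost
import Literature.Computability.ImplicitComplexity.SoftTypeAssignmentFreeVars
import HarnessLib

/-!
# `Λ₊`: reduction, head steps and leftmost steps are reflected along renamings

Small complement to `SoftTypeAssignmentLeftmost.lean` (GMR08 = Gaboardi–Marion–Ronchi Della Rocca
2008, calculus `Λ₊`). Rule `(m)` of `STA₊` types a RENAMED subject `M[x/x₁,…,x/xₙ]`
(`Term.rename (mpxRen S j)`, a non-injective renaming); subject reduction therefore needs that a
reduction step of a renamed term comes from a step of the term: `Red.of_rename`,
`Hd.of_rename`, `Lmo.of_rename` (for ANY renaming `ρ`), together with the invariance of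
normality and neutrality under renaming. Folklore (renamings neither create nor destroy
redexes).

## References

* [GaboardiMarionRonchidellarocca2008] GMR08, Table 2 `(m)`, Def. 5.2.
-/

namespace Literature.Computability.ImplicitComplexity

namespace STA

/-- A `→βγ` step of a renamed term is the renaming of a step of the term. [folklore] -/
theorem Red.of_rename {ρ : ℕ → ℕ} : ∀ {M X : Term}, Red (M.rename ρ) X → ∃ M', Red M M' ∧ X = M'.rename ρ := by
  intro M
  induction M generalizing ρ with
  | var i => intro X h; cases h
  | app M N ihM ihN =>
    intro X h
    generalize e : (Term.app M N).rename ρ = A at h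
    cases h with
    | beta B C =>
      cases M with
      | lam B₀ =>
        simp only [Term.rename, Term.app.injEq, Term.lam.injEq] at e
        obtain ⟨rfl, rfl⟩ := e
        exact ⟨B₀.subst0 N, Red.beta _ _, (Term.subst0_rename _ _ _).symm⟩
      | _ => simp [Term.rename] at e
    | choiceL B C => simp [Term.rename] at e
    | choiceR B C => simp [Term.rename] at e
    | appL C h =>
      simp only [Term.rename, Term.app.injEq] at e
      obtain ⟨rfl, rfl⟩ := e
      obtain ⟨M', hM', rfl⟩ := ihM h
      exact ⟨.app M' N, Red.appL N hM', rfl⟩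
    | appR B h =>
      simp only [Term.rename, Term.app.injEq] at e
      obtain ⟨rfl, rfl⟩ := e
      obtain ⟨N', hN', rfl⟩ := ihN h
      exact ⟨.app M N', Red.appR M hN', rfl⟩
    | lam h => simp [Term.rename] at e
    | sumL C h => simp [Term.rename] at e
    | sumR B h => simp [Term.rename] at e
  | lam M ih =>
    intro X h
    generalize e : (Term.lam M).rename ρ = A at h
    cases h with
    | lam h =>
      simp only [Term.rename, Term.lam.injEq] at e
      subst e
      obtain ⟨M', hM', rfl⟩ := ih h
      exact ⟨.lam M', Red.lam hM', rfl⟩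
    | _ => simp [Term.rename] at e
  | sum M N ihM ihN =>
    intro X h
    generalize e : (Term.sum M N).rename ρ = A at h
    cases h with
    | choiceL B C =>
      simp only [Term.rename, Term.sum.injEq] at e
      obtain ⟨rfl, rfl⟩ := e
      exact ⟨M, Red.choiceL M N, rfl⟩
    | choiceR B C =>
      simp only [Term.rename, Term.sum.injEq] at e
      obtain ⟨rfl, rfl⟩ := e
      exact ⟨N, Red.choiceR M N, rfl⟩
    | sumL C h =>
      simp only [Term.rename, Term.sum.injEq] at e
      obtain ⟨rfl, rfl⟩ := e
      obtain ⟨M', hM', rfl⟩ := ihM h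
      exact ⟨.sum M' N, Red.sumL N hM', rfl⟩
    | sumR B h =>
      simp only [Term.rename, Term.sum.injEq] at e
      obtain ⟨rfl, rfl⟩ := e
      obtain ⟨N', hN', rfl⟩ := ihN h
      exact ⟨.sum M N', Red.sumR M hN', rfl⟩
    | _ => simp [Term.rename] at e

/-- Normality is invariant under renaming. [folklore] -/
theorem normal_rename_iff {ρ : ℕ → ℕ} {M : Term} : Normal (M.rename ρ) ↔ Normal M := by
  constructor
  · exact fun h N hN => h _ (hN.rename ρ)
  · intro h X hX
    obtain ⟨M', hM', _⟩ := Red.of_rename hX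
    exact h _ hM'

/-- Neutrality is invariant under renaming. [folklore] -/
theorem neutral_rename_iff {ρ : ℕ → ℕ} : ∀ {M : Term}, Neutral (M.rename ρ) ↔ Neutral M
  | .var i => ⟨fun _ => Neutral.var i, fun _ => Neutral.var (ρ i)⟩
  | .app M N => by
    constructor
    · intro h
      cases h with
      | app _ h => exact Neutral.app N (neutral_rename_iff.1 h)
    · intro h
      cases h with
      | app _ h => exact Neutral.app _ (neutral_rename_iff.2 h)
  | .lam M => ⟨fun h => (by cases h), fun h => (by cases h)⟩
  | .sum M N => ⟨fun h => (by cases h), fun h => (by cases h)⟩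

/-- A head step of a renamed term is the renaming of a head step of the term. [folklore] -/
theorem Hd.of_rename {ρ : ℕ → ℕ} : ∀ {M X : Term}, Hd (M.rename ρ) X → ∃ M', Hd M M' ∧ X = M'.rename ρ := by
  intro M
  induction M generalizing ρ with
  | var i => intro X h; cases h
  | app M N ihM _ =>
    intro X h
    generalize e : (Term.app M N).rename ρ = A at h
    cases h with
    | beta B C =>
      cases M with
      | lam B₀ =>
        simp only [Term.rename, Term.app.injEq, Term.lam.injEq] at e
        obtain ⟨rfl, rfl⟩ := e
        exact ⟨B₀.subst0 N, Hd.beta _ _, (Term.subst0_rename _ _ _).symm⟩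
      | _ => simp [Term.rename] at e
    | choiceL B C => simp [Term.rename] at e
    | choiceR B C => simp [Term.rename] at e
    | appL C h =>
      simp only [Term.rename, Term.app.injEq] at e
      obtain ⟨rfl, rfl⟩ := e
      obtain ⟨M', hM', rfl⟩ := ihM h
      exact ⟨.app M' N, Hd.appL N hM', rfl⟩
  | lam M _ =>
    intro X h
    generalize e : (Term.lam M).rename ρ = A at h
    cases h <;> simp [Term.rename] at e
  | sum M N _ _ =>
    intro X h
    generalize e : (Term.sum M N).rename ρ = A at h
    cases h with
    | choiceL B C =>
      simp only [Term.rename, Term.sum.injEq] at e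
      obtain ⟨rfl, rfl⟩ := e
      exact ⟨M, Hd.choiceL M N, rfl⟩
    | choiceR B C =>
      simp only [Term.rename, Term.sum.injEq] at e
      obtain ⟨rfl, rfl⟩ := e
      exact ⟨N, Hd.choiceR M N, rfl⟩
    | _ => simp [Term.rename] at e

/-- A leftmost-outermost step of a renamed term is the renaming of a leftmost-outermost step of the
term (the choices at sums being copied). [folklore] -/
theorem Lmo.of_rename {ρ : ℕ → ℕ} : ∀ {M X : Term}, Lmo (M.rename ρ) X → ∃ M', Lmo M M' ∧ X = M'.rename ρ := by
  intro M
  induction M generalizing ρ with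
  | var i =>
    intro X h
    cases h with
    | hd h => cases h
  | app M N ihM ihN =>
    intro X h
    generalize e : (Term.app M N).rename ρ = A at h
    cases h with
    | hd h =>
      subst e
      obtain ⟨M', hM', rfl⟩ := Hd.of_rename h
      exact ⟨M', Lmo.hd hM', rfl⟩
    | lam h => simp [Term.rename] at e
    | appL C hne h =>
      simp only [Term.rename, Term.app.injEq] at e
      obtain ⟨rfl, rfl⟩ := e
      obtain ⟨M', hM', rfl⟩ := ihM h
      exact ⟨.app M' N, Lmo.appL N (neutral_rename_iff.1 hne) hM', rfl⟩
    | appR hne hno h =>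
      simp only [Term.rename, Term.app.injEq] at e
      obtain ⟨rfl, rfl⟩ := e
      obtain ⟨N', hN', rfl⟩ := ihN h
      exact ⟨.app M N', Lmo.appR (neutral_rename_iff.1 hne) (normal_rename_iff.1 hno) hN', rfl⟩
  | lam M ih =>
    intro X h
    generalize e : (Term.lam M).rename ρ = A at h
    cases h with
    | hd h =>
      subst e
      obtain ⟨M', hM', rfl⟩ := Hd.of_rename h
      exact ⟨M', Lmo.hd hM', rfl⟩
    | lam h =>
      simp only [Term.rename, Term.lam.injEq] at e
      subst e
      obtain ⟨M', hM', rfl⟩ := ih h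
      exact ⟨.lam M', Lmo.lam hM', rfl⟩
    | _ => simp [Term.rename] at e
  | sum M N _ _ =>
    intro X h
    generalize e : (Term.sum M N).rename ρ = A at h
    cases h with
    | hd h =>
      subst e
      obtain ⟨M', hM', rfl⟩ := Hd.of_rename h
      exact ⟨M', Lmo.hd hM', rfl⟩
    | _ => simp [Term.rename] at e

/-- Leftmost steps go under abstractions only through their bodies (inversion). [folklore] -/
theorem Lmo.lam_inv' {P X : Term} (h : Lmo (.lam P) X) : ∃ P', Lmo P P' ∧ X = .lam P' := by
  cases h with
  | hd h => cases h
  | lam h => exact ⟨_, h, rfl⟩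

/-- Leftmost steps from a sum are the two choices (inversion). [folklore] -/
theorem Lmo.sum_inv {P Q X : Term} (h : Lmo (.sum P Q) X) : X = P ∨ X = Q := by
  cases h with
  | hd h =>
    cases h with
    | choiceL => exact Or.inl rfl
    | choiceR => exact Or.inr rfl

/-- Leftmost steps from an application (inversion): head `β`, a head step inside the function
part, or an inner step in the function / argument part. [folklore] -/
theorem Lmo.app_inv {M N X : Term} (h : Lmo (.app M N) X) :
    (∃ P, M = .lam P ∧ X = P.subst0 N) ∨ (∃ M', Lmo M M' ∧ X = .app M' N) ∨
      (∃ N', Lmo N N' ∧ X = .app M N') := by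
  cases h with
  | hd h =>
    cases h with
    | beta P N => exact Or.inl ⟨P, rfl, rfl⟩
    | appL N h => exact Or.inr (Or.inl ⟨_, Lmo.hd h, rfl⟩)
  | appL N _ h => exact Or.inr (Or.inl ⟨_, h, rfl⟩)
  | appR _ _ h => exact Or.inr (Or.inr ⟨_, h, rfl⟩)

end STA

end Literature.Computability.ImplicitComplexity
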